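import Summits.HodgeConjecture.CorCM.GaloisOddPrimeUniqueInvolutionOdd
import Summits.HodgeConjecture.CorCM.GaloisSylowCountingNormal
import HarnessLib

/-!
# THE UNIQUE INVOLUTION FROM A NORMAL SUBGROUP OF PRIME ORDER `p` AND INDEX `2ⁿ` — parametrised form (no size hypothesis), with
# the Sylow-counting corollary for degrees `32·p`, `ord_p(2) > 5`

COR-CM (cell `pub-hodgecm2`), binder seat b04 (gen 38), count-neutral own lane «Galois-CM-type classification».  KERNEL ONLY:
theorems; no definition, no named fact, no `sorry`.  `HC_CM` is neither used nor claimed.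

`CorCM/GaloisOddPrimeUniqueInvolutionOdd` derives «complex conjugation is the only involution» from the size hypothesis via the normal
subgroup `P ≅ C_p` of `exists_normal_odd_hall'`.  The argument itself only needs: `[K:ℚ] = 2ⁿ·p` (`p` an odd prime, `n ≥ 5`), `K` GOOD,
and SOME normal subgroup `P ◁ Gal(K/ℚ)` of order `p`.  This file states it in that form (`involution_eq_complexConj_of_normal_prime`,
`sylow_two_isCyclic_or_quaternion_of_normal_prime`, `exists_cyclic_odd_complement_sylow_two_of_normal_prime` — same proofs), so that
ANY source of normality feeds the structure: gen 33's size condition, `p ≥ 31` (`CorCM/GaloisNormalSylow`), or Sylow counting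
(`CorCM/GaloisSylowCountingNormal`).  Corollary (`exists_cyclic_odd_complement_sylow_two_of_forall_dvd`): **`[K:ℚ] = 2ⁿ·p`, `n ≥ 5`, no
`2ⁱ ≡ 1 (mod p)` among the divisors `2ⁱ ≠ 1` of `2ⁿ`, `K` GOOD ⟹ `Gal(K/ℚ) = C_p ⋊ S`, `S` cyclic or generalised quaternion** — e.g.
degree `32·p` for `p ∈ {11, 13, 17, 19, 23, 29}` (and all `p ≥ 37`), where neither gen 33's bound nor `p ≥ 31` applies.

## References

* [Shimura1998] G. Shimura, *Abelian Varieties with Complex Multiplication and Modular Functions*, §6.2 Thm. 3, §8.2 Prop. 26, §32.10.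
* [Gordon1999HodgeAVSurvey] B. B. Gordon, *A survey of the Hodge conjecture for abelian varieties*, Thm. 6.4, §9.3.
* [Dodson1984] B. Dodson, *The structure of Galois groups of CM-fields*, Trans. AMS 283 (1984), §3.1.1, §4.1, §5.
* [Rotman1995] J. J. Rotman, *An Introduction to the Theory of Groups*, 4th ed., GTM 148, Thm. 4.12, Thm. 5.46, Thm. 7.41.
-/

noncomputable section

open CategoryTheory CategoryTheory.Limits NumberField
open scoped BigOperators Pointwise

namespace Summit.HodgeConjecture.CorCM.GaloisModels

open Literature.NumberTheory.ComplexMultiplication Literature.AlgebraicGeometry.HodgeTheory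
open Literature.AlgebraicGeometry.Motives (AbelianVariety CMType)
open Literature.AlgebraicGeometry.ComplexMultiplication (IsCMTypeRealisation)
open Literature.AlgebraicGeometry.Pohlmann1968 Summit.HodgeConjecture.CorCM.GaloisRank
open Literature.Barriers.HodgeConjecture (divisorClassesSpan)
open Summit.HodgeConjecture.CorCM.GaloisOctic (complexConj_mul_comm complexConj_mul_self)
open Summit.HodgeConjecture.CorCM.Complement (exists_simple_degenerate_of_complement)
open Summit.HodgeConjecture.CorCM.GaloisModels.PrimitiveCount (exists_primitive_cm_subgroup_of_card_ge
  mem_zpowers_iff_of_mul_self zpowers_normal_of_comm)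

variable {K : Type} [Field K] [NumberField K] [IsCMField K] [IsGalois ℚ K]

/-! ## §1 The unique involution, from a normal subgroup of order `p` -/

/-- **A NORMAL SUBGROUP OF ODD PRIME ORDER AND INDEX `2ⁿ` (`n ≥ 5`) IN A GOOD FIELD FORCES A UNIQUE INVOLUTION.**  `[K:ℚ] = 2ⁿ·M`, `M` an
odd prime, `P ◁ Gal(K/ℚ)` with `|P| = M`, `K` GOOD ⟹ every involution of `Gal(K/ℚ)` is complex conjugation.
[cite: Shimura1998, §6.2 Thm. 3, §8.2 Prop. 26 and §32.10] [cite: Dodson1984, §3.1.1, §4.1 and §5] [cite: Rotman1995, Thm. 5.46 and Thm. 7.41] -/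
theorem involution_eq_complexConj_of_normal_prime {n M : ℕ} [hMf : Fact M.Prime] (hM2 : M ≠ 2)
    (hdeg : Module.finrank ℚ K = 2 ^ n * M) (hn : 5 ≤ n) (P : Subgroup (K ≃ₐ[ℚ] K)) [hPn : P.Normal] (hcardP : Nat.card P = M)
    (hgood : ∀ (Φ : CMType K) (φ : K →+* ℂ), IsPrimitive (ℂ ≃+* ℂ) Φ.1 φ → IsNondegenerate Φ)
    (σ : K ≃ₐ[ℚ] K) (hσσ : σ * σ = 1) (hσ1 : σ ≠ 1) : σ = (IsCMField.complexConj K).restrictScalars ℚ := by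
  have hM : Odd M := hMf.out.odd_of_ne_two hM2
  have hM1 : M ≠ 1 := hMf.out.one_lt.ne'
  classical
  set c : K ≃ₐ[ℚ] K := (IsCMField.complexConj K).restrictScalars ℚ with hc_def
  have hcz : ∀ g : K ≃ₐ[ℚ] K, c * g = g * c := fun g => complexConj_mul_comm g
  have hcc : c * c = 1 := complexConj_mul_self
  have hc1 : c ≠ 1 := model_complexConj_ne_one (MulEquiv.refl _) rfl
  have hM3 : 3 ≤ M := by
    obtain ⟨k, hk⟩ := hM
    omega
  -- `σ` is central (gen 32/33)
  have h52 : 52 ≤ Module.finrank ℚ K := by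
    rw [hdeg]
    have : 32 ≤ 2 ^ n := by
      calc (32 : ℕ) = 2 ^ 5 := by norm_num
        _ ≤ 2 ^ n := Nat.pow_le_pow_right two_pos hn
    nlinarith
  have hσz : ∀ g : K ≃ₐ[ℚ] K, σ * g = g * σ := fun g =>
    (commute_of_involution_of_forall_isNondegenerate_of_le h52 hgood σ hσσ g).symm
  by_contra hσc
  -- the normal cyclic subgroup `P` of order `M` (a prime) and the GOOD `2`-power field `K^P`
  have hidx : P.index = 2 ^ n := by
    have h := P.card_mul_index
    rw [IsGalois.card_aut_eq_finrank, hdeg, hcardP, mul_comm] at h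
    exact Nat.eq_of_mul_eq_mul_right hMf.out.pos h
  have hcP : c ∉ P := fun hc => by
    have h2 : orderOf c = 2 := orderOf_eq_prime (by rw [pow_two, hcc]) hc1
    have hd : 2 ∣ Nat.card P := by
      rw [← h2, ← Subgroup.orderOf_mk c hc]
      exact orderOf_dvd_natCard (⟨c, hc⟩ : P)
    rw [hcardP] at hd
    exact (Nat.not_even_iff_odd.2 hM) (even_iff_two_dvd.2 hd)
  have hP1 : P ≠ ⊥ := fun h => hM1 (by rw [← hcardP, h, Subgroup.card_bot])
  haveI hCM : IsCMField (IntermediateField.fixedField P) := isCMField_fixedField_of_not_mem P hcP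
  haveI hGal : IsGalois ℚ (IntermediateField.fixedField P) := IsGalois.of_fixedField_normal_subgroup P
  have hdegP : Module.finrank ℚ (IntermediateField.fixedField P) = 2 ^ n := by rw [finrank_fixedField_eq_index P, hidx]
  have hgoodP := isNondegenerate_of_isPrimitive_of_fixedField_of_ne_bot P hcP hP1 hgood
  obtain ⟨Hb, Eb, k, hHE, hcbH, hcbE, hEb, hEcard, hHcard, hstruct⟩ := struct_two_power hdegP hn hgoodP
  -- the restriction `ρ : Gal(K/ℚ) → Gal(K^P/ℚ)`, with kernel `P`, mapping `c ↦ c̄`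
  set ρ := AlgEquiv.restrictNormalHom (F := ℚ) (K₁ := K) (IntermediateField.fixedField P) with hρ
  set cb := (IsCMField.complexConj (IntermediateField.fixedField P)).restrictScalars ℚ with hcb
  have hρc : ρ c = cb := restrictNormalHom_complexConj_of_tower (IntermediateField.fixedField P)
  have hker : ∀ g : K ≃ₐ[ℚ] K, ρ g = 1 → g ∈ P := fun g hg => by
    rw [← IntermediateField.fixingSubgroup_fixedField P, IntermediateField.mem_fixingSubgroup_iff]
    intro x hx
    exact apply_algebraMap_of_restrictNormalHom_eq_one (IntermediateField.fixedField P) hg ⟨x, hx⟩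
  -- no element of order `2` lies in `P`
  have h2P : ∀ g : K ≃ₐ[ℚ] K, g * g = 1 → g ≠ 1 → g ∉ P := fun g hgg hg1 hgP => by
    have h2 : orderOf g = 2 := orderOf_eq_prime (by rw [pow_two, hgg]) hg1
    have hdvd : 2 ∣ Nat.card P := by
      rw [← h2, ← Subgroup.orderOf_mk g hgP]
      exact orderOf_dvd_natCard (⟨g, hgP⟩ : P)
    rw [hcardP] at hdvd
    exact (Nat.not_even_iff_odd.2 hM) (even_iff_two_dvd.2 hdvd)
  -- `σ̄ = ρ σ`: an involution `≠ 1, ≠ c̄`, hence outside `H̄`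
  have hsb2 : ρ σ * ρ σ = 1 := by rw [← map_mul, hσσ, map_one]
  have hsb1 : ρ σ ≠ 1 := fun h => h2P σ hσσ hσ1 (hker σ h)
  have hcb1 : cb ≠ 1 := by rw [hcb]; exact model_complexConj_ne_one (MulEquiv.refl _) rfl
  have hcbcb : cb * cb = 1 := by rw [hcb]; exact complexConj_mul_self
  have hsbc : ρ σ ≠ cb := fun h => by
    have h1 : ρ (σ * c) = 1 := by rw [map_mul, h, hρc, hcbcb]
    have hσcP : σ * c ∈ P := hker _ h1
    by_cases hσc1 : σ * c = 1
    · apply hσc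
      calc σ = σ * (c * c) := by rw [hcc, mul_one]
        _ = σ * c * c := (mul_assoc _ _ _).symm
        _ = c := by rw [hσc1, one_mul]
    · refine h2P (σ * c) ?_ hσc1 hσcP
      calc σ * c * (σ * c) = σ * (c * σ) * c := by simp only [mul_assoc]
        _ = σ * (σ * c) * c := by rw [hcz σ]
        _ = σ * σ * (c * c) := by simp only [mul_assoc]
        _ = 1 := by rw [hσσ, hcc, one_mul]
  have hsbH : ρ σ ∉ Hb := fun h =>
    hsbc (involution_eq_of_isCyclic_or_quaternion Hb hcbH hcbcb hcb1 hHcard hstruct (ρ σ) h hsb2 hsb1)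
  -- `|H̄| · 2 = 2ⁿ`
  have hcardGal : Nat.card (IntermediateField.fixedField P ≃ₐ[ℚ] IntermediateField.fixedField P) = 2 ^ n := by
    rw [IsGalois.card_aut_eq_finrank, hdegP]
  have hHb2 : Nat.card Hb * 2 = 2 ^ n := by
    have h1 := hHE.card_mul
    rw [hcardGal] at h1
    have hE1 : Nat.card Eb ≠ 1 := fun hE => by
      rw [hE, mul_one] at h1
      have htop : Hb = ⊤ := Subgroup.eq_top_of_card_eq Hb (by rw [h1, hcardGal])
      exact hsbH (htop ▸ Subgroup.mem_top _)
    have hEpos : 0 < Nat.card Eb := Nat.card_pos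
    have hE2 : Nat.card Eb = 2 := by omega
    rw [hE2] at h1
    exact h1
  -- a Schur–Zassenhaus complement `Γ'` of `P`; `ρ` is injective on `Γ'`, which contains `c` and `σ`
  have hcop : Nat.Coprime (Nat.card P) P.index := by
    rw [hcardP, hidx]
    exact Nat.Coprime.pow_right _ (Nat.coprime_two_left.2 hM).symm
  obtain ⟨Γ', hPΓ⟩ := Subgroup.exists_right_complement'_of_coprime hcop
  have hoddP : Odd (Nat.card P) := by rw [hcardP]; exact hM
  have hcΓ : c ∈ Γ' := mem_complement_of_odd hPΓ hoddP hcz hcc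
  have hσΓ : σ ∈ Γ' := mem_complement_of_odd hPΓ hoddP hσz hσσ
  have hinjΓ : ∀ g ∈ Γ', ρ g = 1 → g = 1 := fun g hg h => by
    have := hPΓ.disjoint
    rw [Subgroup.disjoint_def] at this
    exact this (hker g h) hg
  -- `H` = the preimage of `H̄` in `Γ'`
  set ρ' : Γ' →* (IntermediateField.fixedField P ≃ₐ[ℚ] IntermediateField.fixedField P) := ρ.comp Γ'.subtype with hρ'
  have hρ'inj : Function.Injective ρ' := by
    rw [← MonoidHom.ker_eq_bot_iff, Subgroup.eq_bot_iff_forall]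
    intro g hg
    exact Subtype.ext (hinjΓ g g.2 (by simpa [hρ'] using hg))
  have hcardΓ : Nat.card Γ' = 2 ^ n := by rw [← hidx]; exact (hPΓ.symm.index_eq_card).symm
  have hρ'surj : Function.Surjective ρ' := by
    have hbij := (Nat.bijective_iff_injective_and_card ρ').2 ⟨hρ'inj, by rw [hcardΓ, hcardGal]⟩
    exact hbij.2
  set H : Subgroup (K ≃ₐ[ℚ] K) := (Hb.comap ρ').map Γ'.subtype with hH
  have hmemH : ∀ g, g ∈ H ↔ g ∈ Γ' ∧ ρ g ∈ Hb := fun g => by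
    rw [hH, Subgroup.mem_map]
    constructor
    · rintro ⟨γ, hγ, rfl⟩
      exact ⟨γ.2, by simpa [hρ'] using hγ⟩
    · rintro ⟨hg, hgH⟩
      exact ⟨⟨g, hg⟩, by simpa [hρ'] using hgH, rfl⟩
  have hcardH : Nat.card H = Nat.card Hb := by
    rw [hH, Subgroup.card_map_of_injective Γ'.subtype_injective]
    have h1 := (Hb.comap ρ').card_mul_index
    rw [Subgroup.index_comap_of_surjective Hb hρ'surj, hcardΓ] at h1
    have h2 := Hb.card_mul_index
    rw [hcardGal] at h2
    have hipos : 0 < Hb.index := Nat.pos_of_ne_zero Subgroup.index_ne_zero_of_finite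
    exact Nat.eq_of_mul_eq_mul_right hipos (h1.trans h2.symm)
  -- hypotheses of §2
  have hcH : c ∈ H := (hmemH c).2 ⟨hcΓ, by rw [hρc]; exact hcbH⟩
  have h14 : 14 ≤ Nat.card H := by
    rw [hcardH]
    have : 32 ≤ 2 ^ n := by
      calc (32 : ℕ) = 2 ^ 5 := by norm_num
        _ ≤ 2 ^ n := Nat.pow_le_pow_right two_pos hn
    omega
  have hPΓdisj : ∀ g, g ∈ P → g ∈ Γ' → g = 1 := fun g hgP hgΓ => by
    have := hPΓ.disjoint
    rw [Subgroup.disjoint_def] at this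
    exact this hgP hgΓ
  have hdisj : ∀ g, g ∈ H → g ∈ P ⊔ Subgroup.zpowers σ → g = 1 := by
    intro g hgH hgN
    obtain ⟨hgΓ, hgHb⟩ := (hmemH g).1 hgH
    obtain ⟨q, hq, hgq⟩ := exists_eq_mul_of_mem_sup_zpowers P hσσ hgN
    have hqΓ : q ∈ Γ' := by
      rcases hgq with h | h
      · rw [← h]; exact hgΓ
      · have : q = g * σ⁻¹ := by rw [h, mul_inv_cancel_right]
        rw [this]
        exact Γ'.mul_mem hgΓ (Γ'.inv_mem hσΓ)
    have hq1 : q = 1 := hPΓdisj q hq hqΓ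
    rcases hgq with h | h
    · rw [h, hq1]
    · exfalso
      apply hsbH
      rw [h, hq1, one_mul] at hgHb
      exact hgHb
  have hcard : Nat.card H * (2 * Nat.card P) = Nat.card (K ≃ₐ[ℚ] K) := by
    rw [hcardH, IsGalois.card_aut_eq_finrank, hdeg, hcardP, ← mul_assoc, hHb2]
  obtain ⟨Φ, φ, X, ι, ϑ, H1, H2, -⟩ :=
    exists_simple_degenerate_of_odd_normal_mul_central_involution P hoddP hP1 σ hσσ hσ1 hσz H hcH h14 hdisj hcard
  exact H2 (hgood Φ φ H1)

/-! ## §2 Sylow `2`-subgroups and the complement -/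

/-- **Sylow `2`-subgroups are cyclic or generalised quaternion** (parametrised form). [cite: Rotman1995, Thm. 5.46]
[cite: Shimura1998, §8.2 Prop. 26 and §32.10] -/
theorem sylow_two_isCyclic_or_quaternion_of_normal_prime {n M : ℕ} [hMf : Fact M.Prime] (hM2 : M ≠ 2)
    (hdeg : Module.finrank ℚ K = 2 ^ n * M) (hn : 5 ≤ n) (P : Subgroup (K ≃ₐ[ℚ] K)) [P.Normal] (hcardP : Nat.card P = M)
    (hgood : ∀ (Φ : CMType K) (φ : K →+* ℂ), IsPrimitive (ℂ ≃+* ℂ) Φ.1 φ → IsNondegenerate Φ)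
    [Fact (Nat.Prime 2)] (S : Sylow 2 (K ≃ₐ[ℚ] K)) :
    Nat.card (S : Subgroup (K ≃ₐ[ℚ] K)) = 2 ^ n ∧
      (IsCyclic (S : Subgroup (K ≃ₐ[ℚ] K)) ∨ Nonempty ((S : Subgroup (K ≃ₐ[ℚ] K)) ≃* QuaternionGroup (2 ^ (n - 2)))) := by
  classical
  have h2M : ¬ 2 ∣ M := fun h => hM2 ((Nat.prime_dvd_prime_iff_eq Nat.prime_two hMf.out).1 h).symm
  obtain ⟨hcard, -⟩ := card_sylow_eq_of_finrank hdeg h2M S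
  refine ⟨hcard, ?_⟩
  have huniq : ∀ s t : (S : Subgroup (K ≃ₐ[ℚ] K)), s * s = 1 → s ≠ 1 → t * t = 1 → t ≠ 1 → s = t := by
    intro s t hss hs1 htt ht1
    apply Subtype.ext
    have hs := involution_eq_complexConj_of_normal_prime hM2 hdeg hn P hcardP hgood (s : K ≃ₐ[ℚ] K)
      (by rw [← Subgroup.coe_mul, hss, Subgroup.coe_one]) (fun h => hs1 (Subtype.ext h))
    have ht := involution_eq_complexConj_of_normal_prime hM2 hdeg hn P hcardP hgood (t : K ≃ₐ[ℚ] K)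
      (by rw [← Subgroup.coe_mul, htt, Subgroup.coe_one]) (fun h => ht1 (Subtype.ext h))
    rw [hs, ht]
  rcases UniqueInvolution.isCyclic_or_nonempty_mulEquiv_quaternionGroup hcard huniq with h | ⟨-, h⟩
  · exact Or.inl h
  · exact Or.inr h

/-- **`Gal(K/ℚ) = P ⋊ S`** (parametrised form, in the output format of `exists_cyclic_odd_complement_sylow_two'`).
[cite: Shimura1998, §8.2 Prop. 26 and §32.10] [cite: Rotman1995, Thm. 4.12, Thm. 5.46 and Thm. 7.41] -/
theorem exists_cyclic_odd_complement_sylow_two_of_normal_prime {n M : ℕ} [hMf : Fact M.Prime] (hM2 : M ≠ 2)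
    (hdeg : Module.finrank ℚ K = 2 ^ n * M) (hn : 5 ≤ n) (P : Subgroup (K ≃ₐ[ℚ] K)) [hPn : P.Normal] (hcardP : Nat.card P = M)
    (hgood : ∀ (Φ : CMType K) (φ : K →+* ℂ), IsPrimitive (ℂ ≃+* ℂ) Φ.1 φ → IsNondegenerate Φ) [Fact (Nat.Prime 2)] :
    ∃ P : Subgroup (K ≃ₐ[ℚ] K), P.Normal ∧ Nat.card P = M ∧ M.Prime ∧ IsCyclic P ∧
      (IsCMField.complexConj K).restrictScalars ℚ ∉ P ∧
      ∀ S : Sylow 2 (K ≃ₐ[ℚ] K), P.IsComplement' (S : Subgroup (K ≃ₐ[ℚ] K)) ∧ Nat.card (S : Subgroup (K ≃ₐ[ℚ] K)) = 2 ^ n ∧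
        (IsCyclic (S : Subgroup (K ≃ₐ[ℚ] K)) ∨ Nonempty ((S : Subgroup (K ≃ₐ[ℚ] K)) ≃* QuaternionGroup (2 ^ (n - 2)))) := by
  classical
  have hM : Odd M := hMf.out.odd_of_ne_two hM2
  haveI : Fact (Nat.card P).Prime := ⟨by rw [hcardP]; exact hMf.out⟩
  have hcP : (IsCMField.complexConj K).restrictScalars ℚ ∉ P := fun hc => by
    have hcc := model_complexConj_mul_self (K := K) (MulEquiv.refl _) rfl
    have hc1 := model_complexConj_ne_one (K := K) (MulEquiv.refl _) rfl
    rw [MulEquiv.refl_apply] at hcc hc1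
    have h2 : orderOf ((IsCMField.complexConj K).restrictScalars ℚ) = 2 := orderOf_eq_prime (by rw [pow_two]; exact hcc) hc1
    have hd : 2 ∣ Nat.card P := by
      rw [← h2, ← Subgroup.orderOf_mk _ hc]
      exact orderOf_dvd_natCard _
    rw [hcardP] at hd
    exact (Nat.not_even_iff_odd.2 hM) (even_iff_two_dvd.2 hd)
  refine ⟨P, hPn, hcardP, hMf.out, isCyclic_of_prime_card (p := Nat.card P) rfl, hcP, fun S => ?_⟩
  obtain ⟨hcardS, hS⟩ := sylow_two_isCyclic_or_quaternion_of_normal_prime hM2 hdeg hn P hcardP hgood S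
  refine ⟨Subgroup.isComplement'_of_card_mul_and_disjoint ?_ ?_, hcardS, hS⟩
  · rw [hcardP, hcardS, IsGalois.card_aut_eq_finrank, hdeg, mul_comm]
  · refine Subgroup.disjoint_of_coprime_natCard ?_
    rw [hcardP, hcardS]
    exact Nat.Coprime.pow_right _ (Nat.coprime_two_left.2 hM).symm

/-! ## §3 Sylow counting as the source of normality -/

/-- **`[K:ℚ] = 2ⁿ·p`, `n ≥ 5`, no divisor `d ≠ 1` of `2ⁿ` with `d ≡ 1 (mod p)` (`ord_p(2) > n`), `K` GOOD ⟹ `Gal(K/ℚ) = C_p ⋊ S` with `S`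
cyclic or generalised quaternion** — the Sylow `p`-subgroup is normal by counting. [cite: Rotman1995, Thm. 4.12 and Thm. 5.46]
[cite: Shimura1998, §8.2 Prop. 26 and §32.10] -/
theorem exists_cyclic_odd_complement_sylow_two_of_forall_dvd {n p : ℕ} [hp : Fact p.Prime] (hp2 : p ≠ 2)
    (hdeg : Module.finrank ℚ K = 2 ^ n * p) (hn : 5 ≤ n) (hdiv : ∀ d : ℕ, d ∣ 2 ^ n → d ≡ 1 [MOD p] → d = 1)
    (hgood : ∀ (Φ : CMType K) (φ : K →+* ℂ), IsPrimitive (ℂ ≃+* ℂ) Φ.1 φ → IsNondegenerate Φ) [Fact (Nat.Prime 2)] :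
    ∃ P : Subgroup (K ≃ₐ[ℚ] K), P.Normal ∧ Nat.card P = p ∧ p.Prime ∧ IsCyclic P ∧
      (IsCMField.complexConj K).restrictScalars ℚ ∉ P ∧
      ∀ S : Sylow 2 (K ≃ₐ[ℚ] K), P.IsComplement' (S : Subgroup (K ≃ₐ[ℚ] K)) ∧ Nat.card (S : Subgroup (K ≃ₐ[ℚ] K)) = 2 ^ n ∧
        (IsCyclic (S : Subgroup (K ≃ₐ[ℚ] K)) ∨ Nonempty ((S : Subgroup (K ≃ₐ[ℚ] K)) ≃* QuaternionGroup (2 ^ (n - 2)))) := by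
  classical
  obtain ⟨Q⟩ := (inferInstance : Nonempty (Sylow p (K ≃ₐ[ℚ] K)))
  have hpr : ¬ p ∣ 2 ^ n := fun h => hp2 ((Nat.prime_dvd_prime_iff_eq hp.out Nat.prime_two).1 (hp.out.dvd_of_dvd_pow h))
  obtain ⟨hcardQ, hidxQ⟩ := card_sylow_eq_of_finrank (by rw [hdeg, pow_one, mul_comm] : Module.finrank ℚ K = p ^ 1 * 2 ^ n) hpr Q
  rw [pow_one] at hcardQ
  haveI : (Q : Subgroup (K ≃ₐ[ℚ] K)).Normal :=
    sylow_normal_of_forall_dvd_index Q (fun d hd hmod => hdiv d (by rw [← hidxQ]; exact hd) hmod)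
  exact exists_cyclic_odd_complement_sylow_two_of_normal_prime hp2 hdeg hn (Q : Subgroup (K ≃ₐ[ℚ] K)) hcardQ hgood

end Summit.HodgeConjecture.CorCM.GaloisModels

end
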